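import Mathlib
import HarnessLib
import HarnessLib.Audit
import Summits.Langlands.Statement
import Literature.NumberTheory.GaloisRepresentations.GaloisRep

/-!
Route: MirrorIrregularPairs

CLOSED (retired) 2026-08-15T13:48:43Z by operator:999:1257524 — reason: not-a-thesis: assembly does not conclude the sub-problem Statement — note: D-0027 §2.1 audit (human 2026-08-15: routes that do not decide the summit are removed): the assembly concludes `EvenReducibleResidueClassification`, not the sub-problem statement; a NEW conforming route may be opened from the same idea (generated `closes : … → _root_.Langlands`).. The file is kept as the record of this route; refuted decls are indexed as negative knowledge (`ledger negatives`).

Route MirrorIrregularPairs (card Langlands/Langlands/conductor-one-mirror-irregular-pairs). Sector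
of the summit served:
direction (B) (Galois → automorphic, Fontaine–Mazur–Langlands) for n = 2, F = ℚ, conductor 1 away
from p, EVEN ρ with
REDUCIBLE residual representation — the sector where (B) must be proved by proving it VACUOUS (no
such irreducible geometric
ρ with distinct Hodge–Tate weights), inside the residually-reducible barrier where Taylor–Wiles has
no traction.

THESIS X (it suffices to show; route-local target `EvenReducibleResidueClassification`): for every
odd prime p, every
continuous σ : Gal(ℚ̄/ℚ) → GL₂(ℚ̄_p) that is unramified outside p, residually reducible of type ω^a
⊕ ω^b (phrased by
traces: ‖tr σ(g) − χ_p(g)^a − χ_p(g)^b‖ < 1 for all g) and even (a + b even ⟺ det σ(c) = +1) is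
REDUCIBLE — unless
p ≡ 1 (mod 4), (b − a) ≡ (p−1)/2 (mod p−1), p | B_{(p−1)/2} (equivalently: the Ankeny–Artin–Chowla
conjecture fails at p;
no such p < 2·10^11) and σ restricted to Gal(ℚ̄/ℚ(√p)) is a sum of two characters (σ is a twist of a
dihedral Artin
representation induced from ℚ(√p)). In particular no irreducible even GEOMETRIC σ with distinct
Hodge–Tate weights and
reducible residue exists (dihedral twists have equal weights or are not de Rham): (B) holds in this
sector, vacuously.

ENGINE (card M1, here crux MirrorCriterion, with the classical input isolated as
KummerHerbrandSplitting): if σ as above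
is irreducible with a ≢ b, BOTH endpoint lattices of Ribet's segment reduce to non-split triangular
representations,
giving non-zero classes in H¹(G_{ℚ,{p,∞}}, ω^{±(b−a)}); for an EVEN exponent j ≢ 0 Kummer theory
over ℚ(μ_p) identifies
h¹(ω^j) with the p-rank of the ODD eigenspace Cl(ℚ(μ_p))(ω^{1−j}) (no local condition at p, no
Vandiver), and Herbrand
gives p | B_j. Hence p | B_m and p | B_{p−1−m}, m = (b−a) mod (p−1): a MIRROR IRREGULAR PAIR. The
scalar residue a ≡ b is
abelian (G_{ℚ,{p,∞}}(p) ≅ ℤ_p), the self-mirror index m = (p−1)/2 is the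
Ankeny–Artin–Chowla/dihedral locus, and what is
left — rigidity at genuine mirror pairs (none below 8192 by the planner's scan; tables exist to
2^31) — is the open crux.

X as a Lean Prop (elaborated, folder SketchInline.lean; constants:
Literature.NumberTheory.GaloisRepresentations.{FramedGaloisRep,
FramedRep.trace, FramedRep.IsIrreducible, FramedGaloisRep.IsUnramifiedAt,
GaloisRep.cyclotomicCharacter}, PadicAlgCl, bernoulli, Rat.num):
∀ (p : ℕ) [Fact p.Prime], p ≠ 2 → ∀ (σ : FramedGaloisRep ℚ (PadicAlgCl p) 2) (a b : ℕ), (∀ v, (p : 𝓞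
ℚ) ∉ v.asIdeal → σ.IsUnramifiedAt v) →
Even (a + b) → (∀ g, ‖FramedRep.trace σ g − (χ g ^ a + χ g ^ b)‖ < 1) → FramedRep.IsIrreducible σ →
p % 4 = 1 ∧ 2 * ((b − a) mod (p − 1)) = p − 1 ∧ (p : ℤ) ∣ (bernoulli ((p−1)/2)).num ∧
∃ P r, r ^ 2 = (p : ℚ̄) ∧ ∀ g, g • r = r → (P σ g P⁻¹)₀₁ = 0 ∧ (P σ g P⁻¹)₁₀ = 0
(χ g := algebraMap ℚ_[p] (PadicAlgCl p) of GaloisRep.cyclotomicCharacter ℚ p g; full one-line form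
in the item).

Rationale: WHY THIS LINE (imports classical cyclotomic arithmetic — Kummer theory, Herbrand/Stickelberger,
Ankeny–Artin–Chowla — and
Ribet–Bellaïche lattice geometry into the even half of (B), where potential automorphy is useless by
design). The even,
residually reducible, conductor-p^∞ sector of Fontaine–Mazur for GL₂/ℚ is recorded in print only
CONDITIONALLY
(Berger2018 Prop. 2 = one Ribet lattice + splitting at p + VANDIVER; Calegari2010/Calegari2011 need
irreducible residue;
SkinnerWiles1999/Pan2022 need oddness). Using BOTH endpoint lattices and reading h¹(G_{ℚ,{p,∞}},
ω^j) for even j off the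
ODD eigenspace of Cl(ℚ(μ_p)) (Kummer, Lang1990 Ch. 6 §1; Herbrand, Lang1990 Ch. 1 §3 Cor. 3) removes
every hypothesis at p
and Vandiver: an irreducible even σ forces a MIRROR irregular pair (p | B_m and p | B_{p−1−m}).
Planning added three facts
the card lacked: the scalar residue is abelian (G_{ℚ,{p,∞}}(p) ≅ ℤ_p), so the sector is COMPLETE;
the self-mirror index
m = (p−1)/2 is exactly the Ankeny–Artin–Chowla locus (AnkenyArtinChowla1952: uh/t ≡ B_{(p−1)/2} mod
p), where even
DIHEDRAL Artin σ induced from ℚ(√p) genuinely exist — so the right target is a classification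
(reducible or dihedral), not
plain vacuity; and a power-sum scan (Σ_{a<p} a^k ≡ pB_k mod p²) finds no mirror pair for p < 8192
(HartHarveyOng2017
tables reach 2^31). The route proves (B) where (B) is vacuous, by a mechanism disjoint from
automorphy lifting.

RANKED CRUXES. r2 MirrorCriterion (the engine; provable now given KummerHerbrandSplitting, whose
statement it carries as
hypothesis; unlocks VoidBelow1024). r3 NonSelfMirrorReducible (OPEN: rigidity of the
expected-dimension-0 even deformation
ring at a genuine mirror pair; no instance known below 8192, possibly below 2^31). r4
SelfMirrorDihedral (OPEN: at
Ankeny–Artin–Chowla counterexample primes every irreducible even σ of type (p−1)/2 is induced from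
ℚ(√p)).
SUPPORT: KummerHerbrandSplitting (known; requested as Literature named fact), ScalarResidueReducible
(Kronecker–Weber),
VoidBelow1024 (the strong vacuity theorem for p < 2^10, kernel-decidable scan), MirrorScan (kit, to
2^31, informal until run).

KILL CRITERIA. (i) An irreducible even σ : G_{ℚ,{p}} → GL₂(ℚ̄_p) with reducible non-scalar residue
at a prime WITHOUT a
mirror pair refutes MirrorCriterion (and the card). (ii) An irreducible even σ with infinite
projective image at a mirror
pair refutes NonSelfMirrorReducible/SelfMirrorDihedral and the classification target; the route then
RETREATS to the
Fontaine–Mazur form (add de Rham + distinct HT weights) — restate, not close. (iii) A mirror pair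
below 1024 refutes
VoidBelow1024 only (not load-bearing; restate the bound). (iv) Novelty kill: a printed
two-lattice/odd-eigenspace
criterion (searched: Berger2018 read p.3; Calegari's notes read by the audit; zbMATH/crossref/S2
queries in NOTES.md) would
regrade the route 'known' but leave r3/r4 and VoidBelow1024 standing.

DELIBERATELY NOT DECOMPOSED: the cup-product presentation of the even deformation ring at a mirror
pair (McCallum–Sharifi;
only worth doing at an actual pair — MirrorScan first); auxiliary tame level T (card M1 variant);
the rank-n
'irregular cycle' criterion (card M4); the conductor-one closure list of (B) for GL₂/ℚ as named
facts (card M6); p = 2.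

NOVELTY/BARRIERS: see the route's Novelty and Barriers fields (nearest prior Berger2018 Prop. 2;
inside
ResiduallyReducibleBarrier's regime by proving non-existence; TaylorWilesNumericalCoincidence is the
heuristic 'dimension 0').

Novelty: NOVELTY (searched 2026-08-15 before writing: `lit read arxiv:1611.09315` p.3 (Prop. 2, Rem. 3
verbatim), `lit read doi:10.1090/mcom/3211` pp.2–3,13 (HHO: data at Harvey's page; Kummer–Vandiver
and λ_p = ν_p = i_p checks, no mirror/AAC statistic), `lit read
book:lang1990-cyclotomic-fields-i-ii` p.28 (Herbrand = Ch.1 §3 Cor.3) and Ch.6 §1 (Kummer pairing),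
`lit search --hybrid "even Galois representation residually reducible Ribet lattice Vandiver
Bernoulli oddness"` (10 books, none on point), `lit search --source zbmath "even Galois
representations residually reducible"` (SkinnerWiles1999; Bellaïche–Pollack 2019 μ-invariants;
Lee–Park 2022 = LOCAL semistable rings, 'even HT weight' ≠ even ρ), `--source crossref "even Galois
representations Fontaine-Mazur reducible"` (Calegari2010, Calegari2011, Ramakrishna 2002, Boston,
Dieulefait, Noot), `--source s2` (Freitas–Sánchez-Rodríguez 2025: comparing reps with equal
reducible residue — unrelated), `--source crossref "Ankeny Artin Chowla"` (AnkenyArtinChowla1952,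
VanderpoortenTerieleWilliams2000, Fellini 2025), galaxy --star all/pdf substring queries (0 rows);
the card's own audit (refuter-novelty-audit gen 0/1) read Calegari's 'Even Galois representations'
notes: no residually reducible criterion.
Nearest prior art: Berger2018 Prop. 2 (arXiv:1611.09315 p.3): ONE Ribet lattice (1 *; 0 ε^m) +
'split at p' (ordinary or short crystalline) ⟹ p | #Cl(ℚ(μ_p))(ε^{−m}) [Khare00 p.275] ⟹ by VANDIVER
m odd ⟹ σ odd; Rem. 3: 'at p crystallinity  [refs: 10.1090/mcom/3211`, 1611.09315, arxiv:1611.09315, doi:10.1090/mcom/3211, book:lang1990-cyclotomic-fields-i-ii, SkinnerWiles1999, Calegari2010, Calegari2011, AnkenyArtinChowla1952, VanderpoortenTerieleWilliams2000, Berger2018, Ribet1976, BellaicheChenevier2009, Lang1990, Washington1997]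

Barriers (technique_class: cyclotomic-reflection ribet-lattice bernoulli-census): technique_class: cyclotomic-reflection ribet-lattice bernoulli-census
- Literature.Barriers.Langlands.ResiduallyReducibleBarrier: the route lives INSIDE this barrier's
regime (reducible residue: Mazur's k ≅ End condition and H⁰(ad⁰) = 0 fail, no Taylor–Wiles primes)
and uses none of the blocked hypotheses, because it proves NON-EXISTENCE (reducible-or-dihedral)
rather than automorphy: no deformation-ring-equals-Hecke-ring, no patching, no residual automorphy.
The barrier's printed content (SkinnerWiles1999: reducible deformation rings not equidimensional;
ordinarity essential) is why a Galois-only criterion is the right tool in the even sector, where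
there is nothing to lift to.
- Literature.Barriers.Langlands.TaylorWilesNumericalCoincidence (and …Narrow): consistent with it
and used as a heuristic only — for even 2-dimensional ρ̄ over ℚ complex conjugation acts trivially
on ad ρ̄, so h¹(ad⁰) − h²(ad⁰) = 0 and the even deformation ring has expected relative dimension 0;
the route never runs patching, it turns 'dimension 0' into Bernoulli arithmetic (MirrorCriterion)
and isolates the genuinely open rigidity statements (NonSelfMirrorReducible, SelfMirrorDihedral)
whose failure mode is precisely an isolated point that dimension counting cannot exclude.
- Literature.Barriers.Langlands.NonRegularWeightBarrier: not engaged as an obstruction; it explains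
why the self-mirror dihedral Artin σ (equal Hodge–Tate weights) are compatible with Fontaine–Mazur
and must appear in the classifi

History (route lifecycle, newest last):
- 2026-08-15T13:48:43Z · CLOSED retired — not-a-thesis: assembly does not conclude the sub-problem Statement (operator:999:1257524)

sub-problem: Langlands · status: closed(retired) · opened planner-plancard-Langlands-Langlands-conducto-96b98e8b-0 2026-08-15T11:13:26Z · rev 1 · ledger route-Langlands-MirrorIrregularPairs
GENERATED by the gate from the ledger (D-0016/17). Provers cite these decls: `theorem foo : Summit.Langlands.Langlands.Theses.MirrorIrregularPairs.<Decl> := …` in Summits/Langlands/Langlands/Theorems/<Name>.lean.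
-/

namespace Summit.Langlands.Langlands.Theses.MirrorIrregularPairs

open scoped BigOperators Topology Manifold Classical MeasureTheory ProbabilityTheory Matrix InnerProductSpace ComplexConjugate ContinuousMap
open Filter Set Function TopologicalSpace MeasureTheory

attribute [summit_statement] _root_.Langlands

/-- item stmt-Langlands-3224 · target · rank 0 · closed · moot by None · by planner
why it might fail: At a mirror pair (none < 8192) or an Ankeny–Artin–Chowla prime (none < 2·10^11) the even root types of Greenberg2016's open-image construction Gal(M/Q)→GL2(Z_p) are present in Gal(M/Q(μ_p))^ab/p; only the relations (h² = rk_p Cl(Q(μ_p))) separate the 'dimension 0' heuristic from an even open-image σ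
sources: Berger2018, Calegari2011, Ribet1976, AnkenyArtinChowla1952, VanderpoortenTerieleWilliams2000, Ramakrishna1998
[target] CLASSIFICATION OF THE EVEN, RESIDUALLY REDUCIBLE, CONDUCTOR-p^∞ SECTOR OF (B) FOR GL2/Q (p
odd): every continuous σ : Γ_ℚ → GL₂(ℚ̄_p) unramified outside p whose residual semisimplification is
ω^a ⊕ ω^b with a+b even (⟺ σ EVEN: det σ(c) ≡ ω^{a+b}(c) = +1 and p is odd) is REDUCIBLE unless p ≡
1 (mod 4), (b−a) ≡ (p−1)/2 (mod p−1), p | B_{(p−1)/2} (⟺ the Ankeny–Artin–Chowla conjecture fails at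
p: uh/t ≡ B_{(p−1)/2} mod p for ε = (t+u√p)/2, h = h(ℚ(√p)); no such p < 2·10^11) and σ|Γ_{ℚ(√p)} is
a sum of two characters (σ = twist of a dihedral Artin representation induced from ℚ(√p)).
Consequence: Fontaine–Mazur/(B) holds in this sector (no irreducible even geometric σ with distinct
Hodge–Tate weights and reducible residue: dihedral twists have equal weights or are not de Rham),
vacuously — the even-reducible-residue piece of 'reciprocity for GL₂ of conductor one over ℚ'.
Typing: residual type by traces ‖tr σ(g) − χ_p(g)^a − χ_p(g)^b‖ < 1 ∀ g (χ_p = p-adic cyclotomic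
character into ℚ̄_p; Brauer–Nesbitt recovers σ̄^ss), evenness as Even (a+b), 'dihedral' as
simultaneous diagonalisability on the stabiliser of a square root r of p in ℚ̄ (= Γ_{ℚ(√p)}). why it
might fail: only through -/
@[route_item "route-Langlands-MirrorIrregularPairs"]
def EvenReducibleResidueClassification : Prop :=
  ∀ (p : ℕ) [Fact p.Prime], p ≠ 2 → ∀ (σ : Literature.NumberTheory.GaloisRepresentations.FramedGaloisRep ℚ (PadicAlgCl p) 2) (a b : ℕ), (∀ v : IsDedekindDomain.HeightOneSpectrum (NumberField.RingOfIntegers ℚ), ((p : ℕ) : NumberField.RingOfIntegers ℚ) ∉ v.asIdeal → σ.IsUnramifiedAt v) → Even (a + b) → (∀ g : Field.absoluteGaloisGroup ℚ, ‖Literature.NumberTheory.GaloisRepresentations.FramedRep.trace σ g - ((algebraMap ℚ_[p] (PadicAlgCl p) (((Literature.NumberTheory.GaloisRepresentations.GaloisRep.cyclotomicCharacter ℚ p g : ℤ_[p]ˣ) : ℤ_[p]) : ℚ_[p])) ^ a + (algebraMap ℚ_[p] (PadicAlgCl p) (((Literature.NumberTheory.GaloisRepresentations.GaloisRep.cyclotomicCharacter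 ℚ p g : ℤ_[p]ˣ) : ℤ_[p]) : ℚ_[p])) ^ b)‖ < 1) → Literature.NumberTheory.GaloisRepresentations.FramedRep.IsIrreducible σ → p % 4 = 1 ∧ 2 * (((b : ℤ) - a) % ((p : ℤ) - 1)).toNat = p - 1 ∧ ((p : ℤ) ∣ (bernoulli ((p - 1) / 2)).num) ∧ (∃ (P : Matrix.GeneralLinearGroup (Fin 2) (PadicAlgCl p)) (r : AlgebraicClosure ℚ), r ^ 2 = (p : AlgebraicClosure ℚ) ∧ ∀ g : Field.absoluteGaloisGroup ℚ, g • r = r → ((P * σ g * P⁻¹ : Matrix.GeneralLinearGroup (Fin 2) (PadicAlgCl p)) : Matrix (Fin 2) (Fin 2) (PadicAlgCl p)) 0 1 = 0 ∧ ((P * σ g * P⁻¹ : Matrix.GeneralLinearGroup (Fin 2) (PadicAlgCl p)) : Matrix (Fin 2) (Fin 2) (PadicAlgCl p)) 1 0 = 0)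

/-- item stmt-Langlands-3226 · crux · rank 3 · closed · moot by None · by planner
why it might fail: At a mirror pair both even root types ω^{±m} occur in Gal(M/Q(μ_p))^ab/p — the input of Greenberg2016's open-image surjection Gal(M/Q)→(pro-p Iwahori)⋊Δ (proved for p-rational K; 'sometimes works' at irregular p, p.32); only the relations (h² = rk_p Cl(Q(μ_p)) ≥ 2) can forbid an even open-image σ.
sources: Greenberg2016, arXiv:1611.06084, MccallumSharifi2003, Ramakrishna1998, Calegari2011, BellaicheChenevier2009
[crux] RIGIDITY AT A GENUINE (NON-SELF) MIRROR PAIR — the open residue of the sector (card M2 as a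
statement): p odd, σ unramified outside p, residual type (a,b), a+b even, m := (b−a) mod (p−1) with
m ∉ {0, (p−1)/2} (typed: ¬ (p−1) ∣ 2(b−a)), and (p; m, p−1−m) a mirror irregular pair (p | B_m ∧ p |
B_{p−1−m}; by MirrorCriterion the only case left, which is why the divisibilities are hypotheses).
CLAIM: σ is reducible. Why believe it: (1) no ARTIN σ has this residual type — a finite subgroup of
GL₂(ℤ̄_p) reducing into a Borel with distinct diagonal characters is P⋊C with P a finite p-group,
and a faithful irreducible plane forces the dihedral shape, i.e. m = (p−1)/2 — so an irreducible σ
here is an even p-adic representation of ℚ of conductor p^∞ with INFINITE projective image, of which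
no example is known at any p; (2) the even deformation ring of the non-split residual extension
(fixed determinant) has expected relative dimension h¹(ad⁰) − h²(ad⁰) = 0 (complex conjugation acts
trivially on ad), its tangent directions are governed by McCallum–Sharifi cup products of cyclotomic
p-units into H²; Fontaine–Mazur forbids the de Rham regular points, the claim forbids all
irreducible poin -/
@[route_item "route-Langlands-MirrorIrregularPairs"]
def NonSelfMirrorReducible : Prop :=
  ∀ (p : ℕ) [Fact p.Prime], p ≠ 2 → ∀ (σ : Literature.NumberTheory.GaloisRepresentations.FramedGaloisRep ℚ (PadicAlgCl p) 2) (a b : ℕ), (∀ v : IsDedekindDomain.HeightOneSpectrum (NumberField.RingOfIntegers ℚ), ((p : ℕ) : NumberField.RingOfIntegers ℚ) ∉ v.asIdeal → σ.IsUnramifiedAt v) → Even (a + b) → ¬ ((p : ℤ) - 1 ∣ 2 * ((b : ℤ) - a)) → (∀ g : Field.absoluteGaloisGroup ℚ, ‖Literature.NumberTheory.GaloisRepresentations.FramedRep.trace σ g - ((algebraMap ℚ_[p] (PadicAlgCl p) (((Literature.NumberTheory.GaloisRepresentations.GaloisRep.cyclotomicCharacter ℚ p g : ℤ_[p]ˣ)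 : ℤ_[p]) : ℚ_[p])) ^ a + (algebraMap ℚ_[p] (PadicAlgCl p) (((Literature.NumberTheory.GaloisRepresentations.GaloisRep.cyclotomicCharacter ℚ p g : ℤ_[p]ˣ) : ℤ_[p]) : ℚ_[p])) ^ b)‖ < 1) → ((p : ℤ) ∣ (bernoulli ((((b : ℤ) - a) % ((p : ℤ) - 1)).toNat)).num) → ((p : ℤ) ∣ (bernoulli (p - 1 - (((b : ℤ) - a) % ((p : ℤ) - 1)).toNat)).num) → ¬ Literature.NumberTheory.GaloisRepresentations.FramedRep.IsIrreducible σ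

/-- item stmt-Langlands-3227 · crux · rank 4 · closed · moot by None · by planner
why it might fail: At an AAC prime the self-inverse root type ω^{(p−1)/2} is present in Gal(M/Q(μ_p))^ab/p, and one toral + ONE such eigen-generator generate a Δ-stable open subgroup of SL2(Z_p) (⟨diag(1+p,(1+p)⁻¹), exp p(e+f)⟩): an open-image even σ is obstructed only by relations; no such p < 2·10^11 to test.
sources: AnkenyArtinChowla1952, VanderpoortenTerieleWilliams2000, HartHarveyOng2017, Ramakrishna1998, BellaicheChenevier2009, Washington1997
[crux] THE SELF-MIRROR INDEX m = (p−1)/2 IS DIHEDRAL (link found while planning): for p ≡ 1 (mod 4)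
let ε = (t+u√p)/2 be the fundamental unit and h the class number of ℚ(√p); Ankeny–Artin–Chowla
(1952) prove uh/t ≡ B_{(p−1)/2} (mod p), so (p, (p−1)/2) is an irregular pair ⟺ p | h·u ⟺ (class
field theory: the τ = −1 part of the p-ray class group of ℚ(√p) unramified outside p is non-zero)
ℚ(√p) has a cyclic degree-p extension unramified outside p and dihedral over ℚ ⟺ there is an EVEN
irreducible ARTIN σ = Ind_{ℚ(√p)}^ℚ χ of p-power conductor, whose residual type is (c, c+(p−1)/2)
(χ̄ = ω^c on Γ_{ℚ(√p)}); these σ and their twists by p-adic characters of G_{ℚ,{p}} are exactly the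
counterexamples to the naive 'no even irreducible σ with reducible residue', and they sit at the
SELF-mirror pair k = p−1−k = (p−1)/2, consistent with MirrorCriterion. None exists for p < 2·10^11
(AAC verified: VanderpoortenTerieleWilliams2000 and successors; every irregular-pair table re-checks
k = (p−1)/2), but AAC is expected to fail for infinitely many p (density ≈ 1/p). CLAIM: at such p
every IRREDUCIBLE σ (unramified outside p, type (a,b) with (b−a) ≡ (p−1)/2 mod (p−1), a+b even;
hypothesis p | B_{(p−1) -/
@[route_item "route-Langlands-MirrorIrregularPairs"]
def SelfMirrorDihedral : Prop :=
  ∀ (p : ℕ) [Fact p.Prime], p ≠ 2 → ∀ (σ : Literature.NumberTheory.GaloisRepresentations.FramedGaloisRep ℚ (PadicAlgCl p) 2) (a b : ℕ), (∀ v : IsDedekindDomain.HeightOneSpectrum (NumberField.RingOfIntegers ℚ), ((p : ℕ) : NumberField.RingOfIntegers ℚ) ∉ v.asIdeal → σ.IsUnramifiedAt v) → Even (a + b) → ¬ ((p : ℤ) - 1 ∣ (b : ℤ) - a) → ((p : ℤ) - 1 ∣ 2 * ((b : ℤ) - a)) → (∀ g : Field.absoluteGaloisGroup ℚ, ‖Literature.NumberTheory.GaloisRepresentations.FramedRep.trace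 σ g - ((algebraMap ℚ_[p] (PadicAlgCl p) (((Literature.NumberTheory.GaloisRepresentations.GaloisRep.cyclotomicCharacter ℚ p g : ℤ_[p]ˣ) : ℤ_[p]) : ℚ_[p])) ^ a + (algebraMap ℚ_[p] (PadicAlgCl p) (((Literature.NumberTheory.GaloisRepresentations.GaloisRep.cyclotomicCharacter ℚ p g : ℤ_[p]ˣ) : ℤ_[p]) : ℚ_[p])) ^ b)‖ < 1) → ((p : ℤ) ∣ (bernoulli ((p - 1) / 2)).num) → Literature.NumberTheory.GaloisRepresentations.FramedRep.IsIrreducible σ → (∃ (P : Matrix.GeneralLinearGroup (Fin 2) (PadicAlgCl p)) (r : AlgebraicClosure ℚ), r ^ 2 = (p : AlgebraicClosure ℚ) ∧ ∀ g : Field.absoluteGaloisGroup ℚ, g • r = r → ((P * σ g * P⁻¹ : Matrix.GeneralLinearGroup (Fin 2) (PadicAlgCl p)) : Matrix (Fin 2) (Fin 2) (PadicAlgCl p)) 0 1 = 0 ∧ ((P * σ g * P⁻¹ : Matrix.GeneralLinearGroup (Fin 2) (PadicAlgCl p)) : Matrix (Fin 2) (Fin 2) (PadicAlgCl p)) 1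 0 = 0)

/-- item stmt-Langlands-3225 · support · rank 2 · closed · moot by None · by planner
why it might fail: Index/normalisation slip (sub/quotient ↔ ω^{±(a−b)}, B_1 sign) is the only mathematical risk; as typed, the ℚ̄_p-coefficient descent to a finite E and 'trace congruence ⟹ ρ̄^ss' must be supplied; may turn out folklore (Berger2018 Prop.2 is the conditional one-lattice form).
sources: Ribet1976, BellaicheChenevier2009, Berger2018, Lang1990, Washington1997
[crux] MIRROR CRITERION (card M1 with normalisations pinned; hypothesis = verbatim the support item
KummerHerbrandSplitting, a known theorem absent from the tree — Stickelberger — so that this item is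
the NEW combination and is provable now): p odd, σ : Γ_ℚ → GL₂(ℚ̄_p) continuous, IRREDUCIBLE,
unramified outside p, residual type (a,b) with a+b even and a ≢ b (mod p−1); m := (b−a) mod (p−1) ∈
{2,4,…,p−3}. THEN p | B_m AND p | B_{p−1−m} ((p; m, p−1−m) is a 'mirror irregular pair'). Proof
plan: (i) σ(Γ_ℚ) ⊂ GL₂(E) for a finite E/ℚ_p (compact image + Baire), stable lattice (tree:
Literature.NumberTheory.GaloisRepresentations.exists_integralModel), reduction ρ̄ over k_E; the
trace congruence gives char.polys (X−ω^a)(X−ω^b), and in dimension 2 Brauer–Nesbitt is elementary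
(kernel of ω^{a−b} on the image is unipotent hence a p-group with a fixed line), so ρ̄^ss = ω^a ⊕
ω^b; (ii) Ribet 1976 Prop. 2.1 / Bellaïche: σ irreducible and ω^a ≠ ω^b ⟹ the stable lattices up to
homothety form a SEGMENT whose two ENDPOINTS reduce to the two NON-SPLIT triangular shapes (ω^a *; 0
ω^b) and (ω^b *; 0 ω^a), each continuous and unramified outside p; (iii) KummerHerbrandSplitting,
contrapositive, applied to -/
@[route_item "route-Langlands-MirrorIrregularPairs"]
def MirrorCriterion : Prop :=
  (∀ (p : ℕ) [Fact p.Prime], p ≠ 2 → ∀ (k : Type) [Field k] [CharP k p] [TopologicalSpace k] [DiscreteTopology k] (ι : ZMod p →+* k) (ρ : Literature.NumberTheory.GaloisRepresentations.FramedGaloisRep ℚ k 2) (a b : ℕ), (∀ v : IsDedekindDomain.HeightOneSpectrum (NumberField.RingOfIntegers ℚ), ((p : ℕ) : NumberField.RingOfIntegers ℚ) ∉ v.asIdeal → ρ.IsUnramifiedAt v) → Even (a + b) → ¬ ((p : ℤ) - 1 ∣ (a : ℤ) - b) → ¬ ((p : ℤ) ∣ (bernoulli ((((a : ℤ) - b)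 % ((p : ℤ) - 1)).toNat)).num) → (∀ g : Field.absoluteGaloisGroup ℚ, ((ρ g : Matrix.GeneralLinearGroup (Fin 2) k) : Matrix (Fin 2) (Fin 2) k) 1 0 = 0 ∧ ((ρ g : Matrix.GeneralLinearGroup (Fin 2) k) : Matrix (Fin 2) (Fin 2) k) 0 0 = (ι (PadicInt.toZMod (((Literature.NumberTheory.GaloisRepresentations.GaloisRep.cyclotomicCharacter ℚ p g : ℤ_[p]ˣ) : ℤ_[p])))) ^ a ∧ ((ρ g : Matrix.GeneralLinearGroup (Fin 2) k) : Matrix (Fin 2) (Fin 2) k) 1 1 = (ι (PadicInt.toZMod (((Literature.NumberTheory.GaloisRepresentations.GaloisRep.cyclotomicCharacter ℚ p g : ℤ_[p]ˣ) : ℤ_[p])))) ^ b) → ∃ P : Matrix.GeneralLinearGroup (Fin 2) k, ∀ g : Field.absoluteGaloisGroup ℚ, ((P * ρ g * P⁻¹ : Matrix.GeneralLinearGroup (Fin 2) k) : Matrix (Fin 2) (Fin 2) k) 0 1 = 0 ∧ ((P * ρ g * P⁻¹ : Matrix.GeneralLinearGroup (Fin 2) k) : Matrix (Fin 2) (Fin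 2) k) 1 0 = 0) → ∀ (p : ℕ) [Fact p.Prime], p ≠ 2 → ∀ (σ : Literature.NumberTheory.GaloisRepresentations.FramedGaloisRep ℚ (PadicAlgCl p) 2) (a b : ℕ), (∀ v : IsDedekindDomain.HeightOneSpectrum (NumberField.RingOfIntegers ℚ), ((p : ℕ) : NumberField.RingOfIntegers ℚ) ∉ v.asIdeal → σ.IsUnramifiedAt v) → Even (a + b) → ¬ ((p : ℤ) - 1 ∣ (b : ℤ) - a) → (∀ g : Field.absoluteGaloisGroup ℚ, ‖Literature.NumberTheory.GaloisRepresentations.FramedRep.trace σ g - ((algebraMap ℚ_[p] (PadicAlgCl p) (((Literature.NumberTheory.GaloisRepresentations.GaloisRep.cyclotomicCharacter ℚ p g : ℤ_[p]ˣ) : ℤ_[p]) : ℚ_[p])) ^ a + (algebraMap ℚ_[p] (PadicAlgCl p) (((Literature.NumberTheory.GaloisRepresentations.GaloisRep.cyclotomicCharacter ℚ p g : ℤ_[p]ˣ) : ℤ_[p]) : ℚ_[p])) ^ b)‖ < 1) → Literature.NumberTheory.GaloisRepresentations.FramedRep.IsIrreducible σ → ((p : ℤ) ∣ (bernoulli ((((b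 : ℤ) - a) % ((p : ℤ) - 1)).toNat)).num) ∧ ((p : ℤ) ∣ (bernoulli (p - 1 - (((b : ℤ) - a) % ((p : ℤ) - 1)).toNat)).num)

/-- item stmt-Langlands-3228 · support · rank 9 · closed · moot by None · by planner
sources: Lang1990, Washington1997, Ribet1976
[support] KUMMER–HERBRAND SPLITTING (KNOWN theorem; requested as a Literature named fact — cite item
filed; heavy to formalise from scratch because of Stickelberger): p odd, k a field of characteristic
p with the discrete topology, ι : ℤ/p → k, ρ̄ : Γ_ℚ → GL₂(k) continuous, unramified outside p, upper
triangular in the given frame with diagonal (ω^a, ω^b) (ω = χ_p mod p pushed into k along ι : ℤ/p →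
k, i.e. ι ∘ PadicInt.toZMod ∘ GaloisRep.cyclotomicCharacter ℚ p; sub = ω^a on e₀, quotient = ω^b),
a+b even, j := (a−b) mod (p−1) ≠ 0, and p ∤ B_j. THEN ρ̄ is split (diagonal in some frame). Paper
proof: the extension class lies in H¹(G_{ℚ,{p,∞}}, k(ω^{a−b})) = H¹(G_{ℚ,{p,∞}}, 𝔽_p(ω^j)) ⊗ k;
inflation–restriction to K = ℚ(μ_p) (degree prime to p) and Kummer theory in K ∋ μ_p (the Kummer
pairing is Δ-equivariant into μ_p, so it pairs the ψ-part of X_S/p with the ωψ^{−1}-part of the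
Kummer radical B ⊂ K^×/K^{×p}, 0 → O_K[1/p]^×/p → B → Cl(K)[p] → 0) give h¹(ω^j) = dim
(O_K[1/p]^×/p)(ω^{1−j}) + dim Cl(K)[p](ω^{1−j}); for j EVEN, 1−j is odd and ≢ 1, and the S-units of
ℚ(μ_p) have no such eigencomponent (real units: even characters; μ_p: ω; 1−ζ: trivial), whence
h¹(ω^j) = dim_𝔽p Cl(K)[p](ω^{ -/
@[route_item "route-Langlands-MirrorIrregularPairs"]
def KummerHerbrandSplitting : Prop :=
  ∀ (p : ℕ) [Fact p.Prime], p ≠ 2 → ∀ (k : Type) [Field k] [CharP k p] [TopologicalSpace k] [DiscreteTopology k] (ι : ZMod p →+* k) (ρ : Literature.NumberTheory.GaloisRepresentations.FramedGaloisRep ℚ k 2) (a b : ℕ), (∀ v : IsDedekindDomain.HeightOneSpectrum (NumberField.RingOfIntegers ℚ), ((p : ℕ) : NumberField.RingOfIntegers ℚ) ∉ v.asIdeal → ρ.IsUnramifiedAt v) → Even (a + b) → ¬ ((p : ℤ) - 1 ∣ (a : ℤ) - b) → ¬ ((p : ℤ) ∣ (bernoulli ((((a : ℤ) - b) % ((p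 : ℤ) - 1)).toNat)).num) → (∀ g : Field.absoluteGaloisGroup ℚ, ((ρ g : Matrix.GeneralLinearGroup (Fin 2) k) : Matrix (Fin 2) (Fin 2) k) 1 0 = 0 ∧ ((ρ g : Matrix.GeneralLinearGroup (Fin 2) k) : Matrix (Fin 2) (Fin 2) k) 0 0 = (ι (PadicInt.toZMod (((Literature.NumberTheory.GaloisRepresentations.GaloisRep.cyclotomicCharacter ℚ p g : ℤ_[p]ˣ) : ℤ_[p])))) ^ a ∧ ((ρ g : Matrix.GeneralLinearGroup (Fin 2) k) : Matrix (Fin 2) (Fin 2) k) 1 1 = (ι (PadicInt.toZMod (((Literature.NumberTheory.GaloisRepresentations.GaloisRep.cyclotomicCharacter ℚ p g : ℤ_[p]ˣ) : ℤ_[p])))) ^ b) → ∃ P : Matrix.GeneralLinearGroup (Fin 2) k, ∀ g : Field.absoluteGaloisGroup ℚ, ((P * ρ g * P⁻¹ : Matrix.GeneralLinearGroup (Fin 2) k) : Matrix (Fin 2) (Fin 2) k) 0 1 = 0 ∧ ((P * ρ g * P⁻¹ : Matrix.GeneralLinearGroup (Fin 2) k) : Matrix (Fin 2) (Fin 2)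 k) 1 0 = 0

/-- item stmt-Langlands-3229 · support · rank 9 · closed · moot by None · by planner
sources: Washington1997
[support] SCALAR RESIDUE IS ABELIAN (settles the card's 'M5, scalar residue, flagged open' for
conductor p^∞): p odd, σ : Γ_ℚ → GL₂(ℚ̄_p) unramified outside p with residual type (a,b), a ≡ b (mod
p−1) (σ̄^ss = ω^a ⊕ ω^a; note such σ is automatically even). THEN σ is reducible. Proof: twist by
the Teichmüller lift of ω^{−a} (finite order, unramified outside p); the image then reduces into a
unipotent group, hence is pro-p, so the twist factors through the maximal pro-p quotient of
G_{ℚ,{p,∞}}, which is pro-cyclic (≅ ℤ_p = Gal of the cyclotomic ℤ_p-extension) because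
Hom(G_{ℚ,{p,∞}}, ℤ/p) is 1-dimensional (Kronecker–Weber: the only ℤ/p-extension of ℚ unramified
outside p is the first cyclotomic layer; p odd); an abelian image has a common eigenvector over
ℚ̄_p, so σ is reducible. Lean needs: Kronecker–Weber / the ℤ/p-extensions of ℚ unramified outside p
(tree: Literature.NumberTheory.GaloisRepresentations.KroneckerWeber*, named facts), a twisting
construction on FramedGaloisRep, pro-p-ness of the congruence subgroup. why it might fail: not
expected to (p = 2 is excluded: Hom(G_{ℚ,{2,∞}}, ℤ/2) has dimension 2 and one-relator-worlds lives
there). Sources: Washington1997 Ch. 14 (Kroneck -/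
@[route_item "route-Langlands-MirrorIrregularPairs"]
def ScalarResidueReducible : Prop :=
  ∀ (p : ℕ) [Fact p.Prime], p ≠ 2 → ∀ (σ : Literature.NumberTheory.GaloisRepresentations.FramedGaloisRep ℚ (PadicAlgCl p) 2) (a b : ℕ), (∀ v : IsDedekindDomain.HeightOneSpectrum (NumberField.RingOfIntegers ℚ), ((p : ℕ) : NumberField.RingOfIntegers ℚ) ∉ v.asIdeal → σ.IsUnramifiedAt v) → ((p : ℤ) - 1 ∣ (b : ℤ) - a) → (∀ g : Field.absoluteGaloisGroup ℚ, ‖Literature.NumberTheory.GaloisRepresentations.FramedRep.trace σ g - ((algebraMap ℚ_[p] (PadicAlgCl p) (((Literature.NumberTheory.GaloisRepresentations.GaloisRep.cyclotomicCharacter ℚ p g : ℤ_[p]ˣ) : ℤ_[p]) : ℚ_[p])) ^ a + (algebraMap ℚ_[p] (PadicAlgCl p) (((Literature.NumberTheory.GaloisRepresentations.GaloisRep.cyclotomicCharacter ℚ p g : ℤ_[p]ˣ) : ℤ_[p]) : ℚ_[p])) ^ b)‖ < 1) → ¬ Literature.NumberTheory.GaloisRepresentations.FramedRep.IsIrreducible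 σ

/-- item stmt-Langlands-3230 · support · rank 9 · closed · moot by None · by planner
sources: HartHarveyOng2017, BuhlerHarvey2011, Washington1997
[support] THE STRONG VACUITY THEOREM BELOW 2^10 (hypothesis = verbatim KummerHerbrandSplitting): for
every odd prime p < 1024, every continuous σ : Γ_ℚ → GL₂(ℚ̄_p) unramified outside p with reducible
residue (type (a,b)) and even (a+b even) is REDUCIBLE — 'no even irreducible 2-dimensional p-adic
Galois representation of conductor p^∞ with reducible reduction exists, geometric or not', new at
each of the 81 irregular pairs with p < 1024 (37, 59, 67, 101, 103, 131, 149, 157, …). Proof =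
MirrorCriterion (fed the hypothesis) + ScalarResidueReducible + a finite check that no prime p <
1024 has a mirror pair {k, p−1−k} of irregular indices (self-pairs k = (p−1)/2 included). The check
is kernel-decidable through the Faulhaber congruence Σ_{a=1}^{p−1} a^k ≡ p·B_k (mod p²) (k even, 2 ≤
k ≤ p−3): p | B_k ⟺ the power sum vanishes mod p²; ≈5·10^7 small modular multiplications for all p <
1024, to be organised prime by prime (one non-divisibility certificate per unordered pair {k,
p−1−k}). The planner ran exactly this in Python (folder scan/mirror_scan.py; scan_2048.txt
reproduces the classical 159 irregular pairs for p < 2048; chunks to 8192): NO mirror pair for p <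
8192. Bound 1024 is chosen -/
@[route_item "route-Langlands-MirrorIrregularPairs"]
def VoidBelow1024 : Prop :=
  (∀ (p : ℕ) [Fact p.Prime], p ≠ 2 → ∀ (k : Type) [Field k] [CharP k p] [TopologicalSpace k] [DiscreteTopology k] (ι : ZMod p →+* k) (ρ : Literature.NumberTheory.GaloisRepresentations.FramedGaloisRep ℚ k 2) (a b : ℕ), (∀ v : IsDedekindDomain.HeightOneSpectrum (NumberField.RingOfIntegers ℚ), ((p : ℕ) : NumberField.RingOfIntegers ℚ) ∉ v.asIdeal → ρ.IsUnramifiedAt v) → Even (a + b) → ¬ ((p : ℤ) - 1 ∣ (a : ℤ) - b) → ¬ ((p : ℤ) ∣ (bernoulli ((((a : ℤ) - b) % ((p : ℤ) - 1)).toNat)).num) → (∀ g : Field.absoluteGaloisGroup ℚ, ((ρ g : Matrix.GeneralLinearGroup (Fin 2) k) : Matrix (Fin 2) (Fin 2) k) 1 0 = 0 ∧ ((ρ g : Matrix.GeneralLinearGroup (Fin 2) k) : Matrix (Fin 2) (Fin 2) k) 0 0 = (ι (PadicInt.toZMod (((Literature.NumberTheory.GaloisRepresentations.GaloisRep.cyclotomicCharacter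 ℚ p g : ℤ_[p]ˣ) : ℤ_[p])))) ^ a ∧ ((ρ g : Matrix.GeneralLinearGroup (Fin 2) k) : Matrix (Fin 2) (Fin 2) k) 1 1 = (ι (PadicInt.toZMod (((Literature.NumberTheory.GaloisRepresentations.GaloisRep.cyclotomicCharacter ℚ p g : ℤ_[p]ˣ) : ℤ_[p])))) ^ b) → ∃ P : Matrix.GeneralLinearGroup (Fin 2) k, ∀ g : Field.absoluteGaloisGroup ℚ, ((P * ρ g * P⁻¹ : Matrix.GeneralLinearGroup (Fin 2) k) : Matrix (Fin 2) (Fin 2) k) 0 1 = 0 ∧ ((P * ρ g * P⁻¹ : Matrix.GeneralLinearGroup (Fin 2) k) : Matrix (Fin 2) (Fin 2) k) 1 0 = 0) → ∀ (p : ℕ) [Fact p.Prime], p ≠ 2 → p < 1024 → ∀ (σ : Literature.NumberTheory.GaloisRepresentations.FramedGaloisRep ℚ (PadicAlgCl p) 2) (a b : ℕ), (∀ v : IsDedekindDomain.HeightOneSpectrum (NumberField.RingOfIntegers ℚ), ((p : ℕ) : NumberField.RingOfIntegers ℚ) ∉ v.asIdeal → σ.IsUnramifiedAt v) → Even (a +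 b) → (∀ g : Field.absoluteGaloisGroup ℚ, ‖Literature.NumberTheory.GaloisRepresentations.FramedRep.trace σ g - ((algebraMap ℚ_[p] (PadicAlgCl p) (((Literature.NumberTheory.GaloisRepresentations.GaloisRep.cyclotomicCharacter ℚ p g : ℤ_[p]ˣ) : ℤ_[p]) : ℚ_[p])) ^ a + (algebraMap ℚ_[p] (PadicAlgCl p) (((Literature.NumberTheory.GaloisRepresentations.GaloisRep.cyclotomicCharacter ℚ p g : ℤ_[p]ˣ) : ℤ_[p]) : ℚ_[p])) ^ b)‖ < 1) → ¬ Literature.NumberTheory.GaloisRepresentations.FramedRep.IsIrreducible σ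

-- item stmt-Langlands-3253 · support · rank 9 · closed · moot by None · by planner — informal only, no Lean statement yet:
--   [support] MIRROR SCAN TO 2^31 (kit job; the card's M3; informal until run, then set-signature):
--   download the complete table of irregular pairs (p, k) for p < 2^31 (HartHarveyOng2017 §1: 'available
--   at the second author's web page' — D. Harvey; 105,097,564 odd primes, Poisson(1/2)-distributed
--   indices) and list every prime with two irregular indices k, k' satisfying k + k' = p − 1, INCLUDING
--   k = k' = (p−1)/2 (that case is an Ankeny–Artin–Chowla counterexample: none expected below 2·10^11,
--   VanderpoortenTerieleWilliams2000). Expected number of genuine mirror pairs below 2^31 under the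
--   Poisson model

/-- item stmt-Langlands-3231 · assembly · rank 1 · closed · moot by None · by planner
[assembly] KummerHerbrandSplitting → MirrorCriterion → NonSelfMirrorReducible → SelfMirrorDihedral →
ScalarResidueReducible → EvenReducibleResidueClassification. Case analysis + integer arithmetic only
(the planner's SketchInlineTest.lean elaborates this skeleton with the three
representation-theoretic cases discharged and only arithmetic left): given σ even of type (a,b),
irreducible: if (p−1) | (b−a), ScalarResidueReducible contradicts irreducibility; else
MirrorCriterion (fed KummerHerbrandSplitting) yields p | B_m ∧ p | B_{p−1−m}; if ¬ (p−1) | 2(b−a),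
NonSelfMirrorReducible contradicts; else m = (p−1)/2 (from (p−1) | 2(b−a), ¬ (p−1) | (b−a), 0 ≤ m <
p−1), m ≡ b−a ≡ a+b ≡ 0 (mod 2) forces p ≡ 1 (mod 4), p | B_m is p | B_{(p−1)/2}, and
SelfMirrorDihedral gives the dihedral clause. Provable now. Sources: this route. -/
@[route_item "route-Langlands-MirrorIrregularPairs"]
def Assembly : Prop :=
  KummerHerbrandSplitting → MirrorCriterion → NonSelfMirrorReducible → SelfMirrorDihedral → ScalarResidueReducible → EvenReducibleResidueClassification

end Summit.Langlands.Langlands.Theses.MirrorIrregularPairs
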